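import Summits.Parity.BatemanHorn.Theorems.SoloInformedOmegaMertensTail
import Literature.NumberTheory.LFunctions.PolynomialRootMertensFirst
import Literature.NumberTheory.Sieve.BatemanHornMertensProduct

/-!
# The one-sided sieve condition `Ω₂(1, K)` for the root count of every Bateman–Horn polynomial

Solo unit `solo-Parity-informed` (ideation tier, informed mode), session 13; `PLAN.md` §21, CLAIMS C57.

For a dimension-one sieve with local densities `ω(p)/p` the Jurkat–Richert theorem (and Iwaniec's
bilinear sieve) asks for the one-sided Mertens condition

  `∏_{w ≤ p < z} (1 - ω(p)/p)⁻¹ ≤ (log z / log w) (1 + K / log w)`   (`2 ≤ w < z`).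

The tree derives it for `ω = ρ_G`, `G` a quadratic with odd constant term
(`Iwaniec1978.rhoG_sieveConditionOne`), from Mertens' first theorem for `ρ_G` with a bounded error.
Here the derivation is made generic (tails: `SoloInformedOmegaMertensTail`):

* `OmegaMertens.prod_inv_one_sub_div_le` — for ANY `ω : ℕ → ℕ` with `ω(p) < p`, `ω(p) ≤ M` at the
  primes and `|∑_{p ≤ t} ω(p) log p / p - log t| ≤ C` (`t ≥ 1`), the condition holds with an explicit
  `K = K(M, C)`. The only new point over the quadratic case is the factor bound
  `(1 - ω(p)/p)⁻¹ ≤ exp(t + (4M+3) t²)`, `t = ω(p)/p`, valid also at the finitely many primes with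
  `ω(p)/p > 2/3` (there `(1 - t)⁻¹ ≤ p < 3M/2`);
* `rootCount_sieveConditionOne` — the condition for `ω = ρ_g = polyRootCountMod ![g]`, for EVERY
  `g ∈ ℤ[X]` of positive degree forming a Bateman–Horn system, the Mertens input being the tree's
  prime-ideal-theorem consequence `DegreeOnePrimes.abs_sum_primesLE_rootCount_mul_log_div_sub_log_le`
  (Landau 1903) and the bounds `ρ_g(p) ≤ deg g`, `ρ_g(p) < p`.

This removes the restriction "degree `2`" from the classical upper-bound sieve for prime values of one
polynomial (`SoloInformedPolynomialUpperBound`).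

References: H. Halberstam, H.-E. Richert, *Sieve Methods* (Academic Press 1974) Ch. 2 (`Ω₂(κ, L)`) and
Thm 5.3; H. Iwaniec, Acta Arith. 37 (1980) 307–320, condition (1); E. Landau, Math. Ann. 56 (1903)
645–670; P. T. Bateman, R. A. Horn, Math. Comp. 16 (1962) 363–367 [BatemanHorn1962].
-/

open Finset Real Filter MeasureTheory Polynomial
open scoped Topology

noncomputable section

namespace Summit.Parity.BatemanHorn.Theorems

open Literature.NumberTheory.Sieve (polyRootCountMod IsBatemanHornSystem)
open Literature.NumberTheory.Sieve.Iwaniec1978 (inv_one_sub_le_exp_of_le_two_thirds exp_le_one_add_mul_exp)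

namespace OmegaMertens

variable {ω : ℕ → ℕ}

/-- The factor bound `(1 - ω(p)/p)⁻¹ ≤ exp(t + (4M + 3) t²)`, `t = ω(p)/p`, for `ω(p) < p`,
`ω(p) ≤ M`: for `t ≤ 2/3` this is `(1 - t)⁻¹ ≤ exp(t + 3t²)`; for `t > 2/3` one has `p < 3M/2` and
`(1 - t)⁻¹ ≤ p ≤ 1 + (4M+3)(4/9) ≤ exp(t + (4M+3)t²)`. -/
theorem inv_one_sub_div_le_exp {M p : ℕ} (hp : p.Prime) (hlt : ω p < p) (hle : ω p ≤ M) :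
    (1 - (ω p : ℝ) / p)⁻¹ ≤ Real.exp ((ω p : ℝ) / p + (4 * M + 3) * ((ω p : ℝ) / p) ^ 2) := by
  have hp0 : (0 : ℝ) < p := by exact_mod_cast hp.pos
  have hM0 : (0 : ℝ) ≤ M := Nat.cast_nonneg _
  set t : ℝ := (ω p : ℝ) / p with ht
  have ht0 : 0 ≤ t := by positivity
  have hωp : (ω p : ℝ) + 1 ≤ p := by exact_mod_cast hlt
  have ht1 : (p : ℝ)⁻¹ ≤ 1 - t := by
    have h1 : t + (p : ℝ)⁻¹ = ((ω p : ℝ) + 1) / p := by rw [ht]; field_simp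
    have h2 : ((ω p : ℝ) + 1) / p ≤ 1 := by rw [div_le_one hp0]; exact hωp
    linarith
  by_cases h3 : 3 * ω p ≤ 2 * p
  · have h23 : t ≤ 2 / 3 := by
      rw [ht, div_le_div_iff₀ hp0 (by norm_num)]
      have : (3 : ℝ) * (ω p : ℝ) ≤ 2 * p := by exact_mod_cast h3
      linarith
    refine (inv_one_sub_le_exp_of_le_two_thirds h23).trans (Real.exp_le_exp.mpr ?_)
    nlinarith [sq_nonneg t]
  · push Not at h3
    have h23 : 2 / 3 < t := by
      rw [ht, lt_div_iff₀ hp0]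
      have : (2 : ℝ) * p < 3 * (ω p : ℝ) := by exact_mod_cast h3
      linarith
    have hpM : (p : ℝ) < 3 / 2 * M := by
      have : 2 * p < 3 * M := lt_of_lt_of_le h3 (Nat.mul_le_mul_left 3 hle)
      have h' : (2 : ℝ) * p < 3 * M := by exact_mod_cast this
      linarith
    have hpos : 0 < 1 - t := lt_of_lt_of_le (inv_pos.mpr hp0) ht1
    have hinv : (1 - t)⁻¹ ≤ p := (inv_le_comm₀ hpos hp0).mpr ht1
    refine hinv.trans ?_
    have hexp := Real.add_one_le_exp (t + (4 * M + 3) * t ^ 2)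
    have ht2 : 4 / 9 ≤ t ^ 2 := by nlinarith
    have hA : (4 * (M : ℝ) + 3) * (4 / 9) ≤ (4 * M + 3) * t ^ 2 :=
      mul_le_mul_of_nonneg_left ht2 (by linarith)
    linarith

/-- `∑_{w ≤ p < z} (ω(p)/p)² ≤ 2M² / w` for `w ≥ 2` when `ω(p) ≤ M`. -/
theorem sum_omega_div_sq_le {M : ℕ} (hM : ∀ p : ℕ, p.Prime → ω p ≤ M)
    {w z : ℝ} (hw : 2 ≤ w) :
    ∑ p ∈ (Nat.primesBelow ⌈z⌉₊).filter (fun p : ℕ => w ≤ (p : ℝ)), ((ω p : ℝ) / p) ^ 2 ≤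
      2 * (M : ℝ) ^ 2 / w := by
  set k : ℕ := ⌈w⌉₊ - 1 with hk
  have hceil : 1 ≤ ⌈w⌉₊ := Nat.one_le_iff_ne_zero.mpr (Nat.ceil_pos.mpr (by linarith)).ne'
  set S := (Nat.primesBelow ⌈z⌉₊).filter (fun p : ℕ => w ≤ (p : ℝ)) with hS
  have hsub : S ⊆ Ioo k ⌈z⌉₊ := by
    intro p hp
    simp only [hS, Finset.mem_filter, Nat.mem_primesBelow, Finset.mem_Ioo] at hp ⊢
    obtain ⟨⟨hpz, hpp⟩, hwp⟩ := hp
    refine ⟨?_, hpz⟩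
    have : ⌈w⌉₊ ≤ p := Nat.ceil_le.mpr hwp
    omega
  have h1 : ∀ p ∈ S, ((ω p : ℝ) / p) ^ 2 ≤ (M : ℝ) ^ 2 * ((p : ℝ) ^ 2)⁻¹ := by
    intro p hp
    have hpp : p.Prime := (Nat.mem_primesBelow.mp (Finset.mem_filter.mp hp).1).2
    have h2 : (ω p : ℝ) ≤ M := by exact_mod_cast hM p hpp
    have hp0 : (0 : ℝ) < p := by exact_mod_cast hpp.pos
    rw [div_pow, div_eq_mul_inv]
    gcongr
  calc ∑ p ∈ S, ((ω p : ℝ) / p) ^ 2 ≤ ∑ p ∈ S, (M : ℝ) ^ 2 * ((p : ℝ) ^ 2)⁻¹ := Finset.sum_le_sum h1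
    _ ≤ ∑ i ∈ Ioo k ⌈z⌉₊, (M : ℝ) ^ 2 * ((i : ℝ) ^ 2)⁻¹ :=
        Finset.sum_le_sum_of_subset_of_nonneg hsub fun i _ _ => by positivity
    _ = (M : ℝ) ^ 2 * ∑ i ∈ Ioo k ⌈z⌉₊, ((i : ℝ) ^ 2)⁻¹ := by rw [Finset.mul_sum]
    _ ≤ (M : ℝ) ^ 2 * (2 / (k + 1)) := by gcongr; exact sum_Ioo_inv_sq_le k ⌈z⌉₊
    _ = 2 * (M : ℝ) ^ 2 / (⌈w⌉₊ : ℝ) := by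
        rw [hk, Nat.cast_sub hceil]; push_cast; ring
    _ ≤ 2 * (M : ℝ) ^ 2 / w := div_le_div_of_nonneg_left (by positivity) (by linarith) (Nat.le_ceil w)

/-- **The sieve condition from Mertens I.** For `ω : ℕ → ℕ` with `ω(p) < p` and `ω(p) ≤ M` at the
primes and `|∑_{p ≤ t} ω(p) log p/p - log t| ≤ C` (`t ≥ 1`) there is `K ≥ 1` with
`∏_{w ≤ p < z} (1 − ω(p)/p)⁻¹ ≤ (log z / log w)(1 + K / log w)` for all `2 ≤ w < z`. -/
theorem prod_inv_one_sub_div_le {M : ℕ} (hM : ∀ p : ℕ, p.Prime → ω p ≤ M)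
    (hlt : ∀ p : ℕ, p.Prime → ω p < p)
    {C : ℝ} (hC : ∀ t : ℝ, 1 ≤ t → |omegaLogSum ω t - Real.log t| ≤ C) :
    ∃ K : ℝ, 1 ≤ K ∧ ∀ w z : ℝ, 2 ≤ w → w < z →
      ∏ p ∈ (Nat.primesBelow ⌈z⌉₊).filter (fun p : ℕ => w ≤ (p : ℝ)), (1 - (ω p : ℝ) / p)⁻¹ ≤
        Real.log z / Real.log w * (1 + K / Real.log w) := by
  have hC0 : 0 ≤ C := by
    have := hC 1 le_rfl
    exact (abs_nonneg _).trans this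
  have hM0 : (0 : ℝ) ≤ M := Nat.cast_nonneg _
  have h2 : ω 2 ≤ 1 := by have := hlt 2 Nat.prime_two; omega
  set A : ℝ := 4 * M + 3 with hA
  have hA0 : 0 ≤ A := by rw [hA]; positivity
  set C₃ : ℝ := 5 + 12 * C + A * (2 * (M : ℝ) ^ 2) with hC₃
  have hC₃0 : 0 ≤ C₃ := by rw [hC₃]; positivity
  have hlog2 : 0 < Real.log 2 := Real.log_pos (by norm_num)
  refine ⟨C₃ * Real.exp (C₃ / Real.log 2), ?_, ?_⟩
  · have h1 : (1 : ℝ) ≤ Real.exp (C₃ / Real.log 2) := Real.one_le_exp (by positivity)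
    have h16 : (5 : ℝ) ≤ C₃ := by rw [hC₃]; nlinarith
    nlinarith
  intro w z hw hwz
  set S := (Nat.primesBelow ⌈z⌉₊).filter (fun p : ℕ => w ≤ (p : ℝ)) with hS
  have hlogw : 0 < Real.log w := Real.log_pos (by linarith)
  have hlogz : 0 < Real.log z := Real.log_pos (by linarith)
  have hlogw2 : Real.log 2 ≤ Real.log w := Real.log_le_log (by norm_num) hw
  have hmemS : ∀ p ∈ S, p.Prime := fun p hp =>
    (Nat.mem_primesBelow.mp (Finset.mem_filter.mp hp).1).2
  -- each factor is at most `exp(t + A t²)`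
  have hfac : ∀ p ∈ S, (1 - (ω p : ℝ) / p)⁻¹ ≤
      Real.exp ((ω p : ℝ) / p + A * ((ω p : ℝ) / p) ^ 2) := fun p hp =>
    inv_one_sub_div_le_exp (hmemS p hp) (hlt p (hmemS p hp)) (hM p (hmemS p hp))
  have hnn : ∀ p ∈ S, 0 ≤ (1 - (ω p : ℝ) / p)⁻¹ := fun p hp => by
    have hpp := hmemS p hp
    have hp0 : (0 : ℝ) < p := by exact_mod_cast hpp.pos
    have : (ω p : ℝ) / p < 1 := by
      rw [div_lt_one hp0]; exact_mod_cast hlt p hpp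
    exact inv_nonneg.mpr (by linarith)
  have h1 : ∏ p ∈ S, (1 - (ω p : ℝ) / p)⁻¹ ≤
      Real.exp (∑ p ∈ S, ((ω p : ℝ) / p + A * ((ω p : ℝ) / p) ^ 2)) := by
    rw [Real.exp_sum]
    exact Finset.prod_le_prod hnn hfac
  have h2' : ∑ p ∈ S, ((ω p : ℝ) / p + A * ((ω p : ℝ) / p) ^ 2) ≤
      Real.log (Real.log z / Real.log w) + C₃ / Real.log w := by
    rw [Finset.sum_add_distrib, ← Finset.mul_sum]
    have hA' := sum_omega_div_filter_le h2 hC hw hwz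
    have hB := sum_omega_div_sq_le hM (z := z) hw
    have hw0 : 0 < w := by linarith
    have hlw : Real.log w ≤ w := by
      have := Real.log_le_sub_one_of_pos hw0; linarith
    have h24 : A * (2 * (M : ℝ) ^ 2 / w) ≤ A * (2 * (M : ℝ) ^ 2) / Real.log w := by
      rw [← mul_div_assoc]
      exact div_le_div_of_nonneg_left (by positivity) hlogw hlw
    have hAB : A * ∑ p ∈ S, ((ω p : ℝ) / p) ^ 2 ≤ A * (2 * (M : ℝ) ^ 2 / w) :=
      mul_le_mul_of_nonneg_left hB hA0
    have : (5 + 12 * C) / Real.log w + A * (2 * (M : ℝ) ^ 2) / Real.log w = C₃ / Real.log w := by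
      rw [hC₃]; ring
    linarith
  have h3 : Real.exp (Real.log (Real.log z / Real.log w) + C₃ / Real.log w) =
      Real.log z / Real.log w * Real.exp (C₃ / Real.log w) := by
    rw [Real.exp_add, Real.exp_log (div_pos hlogz hlogw)]
  have h4 : Real.exp (C₃ / Real.log w) ≤ 1 + C₃ * Real.exp (C₃ / Real.log 2) / Real.log w := by
    have hu := exp_le_one_add_mul_exp (C₃ / Real.log w)
    have hmono : Real.exp (C₃ / Real.log w) ≤ Real.exp (C₃ / Real.log 2) :=
      Real.exp_le_exp.mpr (div_le_div_of_nonneg_left hC₃0 hlog2 hlogw2)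
    have hu0 : 0 ≤ C₃ / Real.log w := by positivity
    calc Real.exp (C₃ / Real.log w) ≤ 1 + C₃ / Real.log w * Real.exp (C₃ / Real.log w) := hu
      _ ≤ 1 + C₃ / Real.log w * Real.exp (C₃ / Real.log 2) := by gcongr
      _ = 1 + C₃ * Real.exp (C₃ / Real.log 2) / Real.log w := by ring
  calc ∏ p ∈ S, (1 - (ω p : ℝ) / p)⁻¹
      ≤ Real.exp (∑ p ∈ S, ((ω p : ℝ) / p + A * ((ω p : ℝ) / p) ^ 2)) := h1
    _ ≤ Real.exp (Real.log (Real.log z / Real.log w) + C₃ / Real.log w) := Real.exp_le_exp.mpr h2'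
    _ = Real.log z / Real.log w * Real.exp (C₃ / Real.log w) := h3
    _ ≤ Real.log z / Real.log w * (1 + C₃ * Real.exp (C₃ / Real.log 2) / Real.log w) := by
        gcongr

/-- The tail form of Mertens II: `∑_{w ≤ p < z} ω(p)/p ≤ log(log z/log w) + C₂/log w` with
`C₂ = C₂(ω)`, under the same hypotheses. -/
theorem exists_sum_omega_div_filter_le (hlt : ∀ p : ℕ, p.Prime → ω p < p)
    {C : ℝ} (hC : ∀ t : ℝ, 1 ≤ t → |omegaLogSum ω t - Real.log t| ≤ C) :
    ∃ C₂ : ℝ, ∀ w z : ℝ, 2 ≤ w → w < z →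
      ∑ p ∈ (Nat.primesBelow ⌈z⌉₊).filter (fun p : ℕ => w ≤ (p : ℝ)), (ω p : ℝ) / p ≤
        Real.log (Real.log z / Real.log w) + C₂ / Real.log w := by
  have h2 : ω 2 ≤ 1 := by have := hlt 2 Nat.prime_two; omega
  exact ⟨5 + 12 * C, fun w z hw hwz => sum_omega_div_filter_le h2 hC hw hwz⟩

end OmegaMertens

/-! ### The sieve condition for `ρ_g`, every Bateman–Horn polynomial `g` -/

open OmegaMertens

/-- **Mertens I for `ρ_g`, real form.** For `g` of positive degree forming a Bateman–Horn system:
`|∑_{p ≤ t} ρ_g(p) log p / p - log t| ≤ C_g` for all real `t ≥ 1`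
(`DegreeOnePrimes.abs_sum_primesLE_rootCount_mul_log_div_sub_log_le`, Landau's prime ideal theorem
for the degree-one primes of `ℚ[x]/(g)`). -/
theorem rootCount_mertensFirst {g : ℤ[X]} (hg : IsBatemanHornSystem ![g]) (hdeg : 0 < g.natDegree) :
    ∃ C : ℝ, ∀ t : ℝ, 1 ≤ t →
      |omegaLogSum (fun p => polyRootCountMod ![g] p) t - Real.log t| ≤ C := by
  have hirr : Irreducible g := by simpa using hg.irreducible 0
  obtain ⟨C, hC⟩ :=
    Literature.NumberTheory.LFunctions.DegreeOnePrimes.abs_sum_primesLE_rootCount_mul_log_div_sub_log_le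
      g hirr hdeg
  exact ⟨C + Real.log 2, abs_omegaLogSum_sub_log_le (ω := fun p => polyRootCountMod ![g] p) hC⟩

/-- **The sieve condition `Ω₂(1, K)` for `ρ_g`.** For every `g ∈ ℤ[X]` of positive degree forming a
Bateman–Horn system there is `K = K_g ≥ 1` with
`∏_{w ≤ p < z} (1 - ρ_g(p)/p)⁻¹ ≤ (log z / log w)(1 + K / log w)` for all `2 ≤ w < z`
(Halberstam–Richert, *Sieve Methods*, (2.3.4) with `κ = 1` for the sequence `{g(n)}`; the input is
Mertens I for `ρ_g` with a bounded error, `ρ_g(p) ≤ deg g` and `ρ_g(p) < p`). -/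
theorem rootCount_sieveConditionOne {g : ℤ[X]} (hg : IsBatemanHornSystem ![g])
    (hdeg : 0 < g.natDegree) :
    ∃ K : ℝ, 1 ≤ K ∧ ∀ w z : ℝ, 2 ≤ w → w < z →
      ∏ p ∈ (Nat.primesBelow ⌈z⌉₊).filter (fun p : ℕ => w ≤ (p : ℝ)),
          (1 - (polyRootCountMod ![g] p : ℝ) / p)⁻¹ ≤
        Real.log z / Real.log w * (1 + K / Real.log w) := by
  obtain ⟨C, hC⟩ := rootCount_mertensFirst hg hdeg
  have hM : ∀ p : ℕ, p.Prime → (fun p => polyRootCountMod ![g] p) p ≤ g.natDegree := fun p hp => by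
    have h := Literature.NumberTheory.Sieve.BatemanHornMertens.rootCount_single_le_natDegree hg 0 hp
    simpa using h
  have hlt : ∀ p : ℕ, p.Prime → (fun p => polyRootCountMod ![g] p) p < p := fun p hp => by
    have h := Literature.NumberTheory.Sieve.BatemanHornMertens.rootCount_single_lt hg 0 hp
    simpa using h
  exact prod_inv_one_sub_div_le hM hlt hC

/-- The tail form of Mertens II for `ρ_g`: `∑_{w ≤ p < z} ρ_g(p)/p ≤ log(log z/log w) + C₂/log w`
(`2 ≤ w < z`). -/
theorem rootCount_sum_div_filter_le {g : ℤ[X]} (hg : IsBatemanHornSystem ![g])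
    (hdeg : 0 < g.natDegree) :
    ∃ C₂ : ℝ, ∀ w z : ℝ, 2 ≤ w → w < z →
      ∑ p ∈ (Nat.primesBelow ⌈z⌉₊).filter (fun p : ℕ => w ≤ (p : ℝ)),
          (polyRootCountMod ![g] p : ℝ) / p ≤
        Real.log (Real.log z / Real.log w) + C₂ / Real.log w := by
  obtain ⟨C, hC⟩ := rootCount_mertensFirst hg hdeg
  have hlt : ∀ p : ℕ, p.Prime → (fun p => polyRootCountMod ![g] p) p < p := fun p hp => by
    have h := Literature.NumberTheory.Sieve.BatemanHornMertens.rootCount_single_lt hg 0 hp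
    simpa using h
  exact exists_sum_omega_div_filter_le hlt hC

end Summit.Parity.BatemanHorn.Theorems

end
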